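import Summits.NavierStokesRegularity.NavierStokesRegularity.Theorems.LerayQuarterDissipationFiniteDissipationLiouvilleBlowdownLeaf
import Literature.Analysis.FluidPDE.NewtonPotentialHolder
import HarnessLib

/-!
# `FiniteDissipationLiouville`, line `birth`: the far-field leaf of the DSS wall — a Type-I DSS
# singularity must be visible at spatial infinity on every slice

Crux `Summit.NavierStokesRegularity.NavierStokesRegularity.Theses.LerayQuarterDissipation.FiniteDissipationLiouville`
(item stmt-NavierStokesRegularity-22144), route LerayQuarterDissipation, line `birth`, lead prover
ns-lqd-lead g2. NS regularity is NOT proved by anything here; no summit is.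

A `λ`-DSS member `w` of the finite-dissipation Type-I stratum obeys the space-time envelope
`‖w(t,x)‖ ≤ C₀/(‖x‖ + √(−t))` (bridge `exists_hasTypeIDecay_of_dss`), so on every slice
`‖x‖ ‖w(t₀,x)‖ ≤ C₀`. This file proves that for a NONTRIVIAL member this product does not tend to
zero at spatial infinity on any slice:

* `tendsto_integral_inner_blowdown_of_farField` — if `‖x‖‖w(t₀,x)‖ → 0` as `‖x‖ → ∞` and
  `‖w(t₀,x)‖ ≤ C₀/(‖x‖ + a)` (`a > 0`), then the Navier–Stokes blow-downs `λ w(t₀)(λ·)` tend to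
  `0` in `𝒟'` as `λ → +∞` (dominated convergence against `C₀ ‖x‖⁻¹ ‖φ(x)‖`, integrable since
  `‖x‖⁻¹ ∈ L¹_loc(ℝ³)`);
* `eq_zero_of_pastDss_of_farField_decay` — **far-field leaf, every `λ > 1`**: a past-DSS member
  of the stratum with ONE slice satisfying `‖x‖‖w(t₀,x)‖ → 0` at infinity vanishes on `t < 0`
  (`eq_zero_of_pastDss_of_blowdown_tendsto_zero`, Albritton–Barker 2019 Thm 4.1);
* `farField_limsup_pos_of_pastDss_singular` — contrapositive: a singular past-DSS member has, on
  EVERY slice, `‖x‖‖w(t₀,x)‖ ≥ ε` for some `ε > 0` along points `‖x‖ → ∞` (the homogeneous final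
  datum is seen at spatial infinity of every slice).
-/

noncomputable section

open MeasureTheory Set Function Filter Metric
open scoped Topology ENNReal NNReal RealInnerProductSpace

namespace Summit.NavierStokesRegularity.NavierStokesRegularity.Theorems.FiniteDissipationLiouville.Birth

open Literature.Analysis.FluidPDE

-- the problem-side namespace duplicates `NavierStokesRegularity` by design (summit = problem)
set_option linter.dupNamespace false

/-- **Far-field decay of a slice makes its blow-downs trivial.** Let `g : ℝ³ → ℝ³` be continuous
with `‖g(y)‖ ≤ C₀/(‖y‖ + a)` for some `a > 0` and `‖y‖‖g(y)‖ → 0` as `‖y‖ → ∞` (in the form: for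
every `ε > 0` there is `R` with `‖y‖‖g(y)‖ ≤ ε` for `‖y‖ ≥ R`). Then for every smooth compactly
supported `φ`, `∫ ⟪λ g(λx), φ(x)⟫ dx → 0` as `λ → +∞`: pointwise `λ‖g(λx)‖ → 0` for `x ≠ 0`, with
the integrable majorant `C₀‖x‖⁻¹‖φ(x)‖` (`‖x‖⁻¹ ∈ L¹_loc(ℝ³)`, `integrableOn_ball_norm_rpow_neg`). -/
theorem tendsto_integral_inner_blowdown_of_farField
    {g : EuclideanSpace ℝ (Fin 3) → EuclideanSpace ℝ (Fin 3)} (hg : Continuous g) {C₀ a : ℝ}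
    (ha : 0 < a) (henv : ∀ y, ‖g y‖ ≤ C₀ / (‖y‖ + a))
    (hfar : ∀ ε > 0, ∃ R : ℝ, ∀ y, R ≤ ‖y‖ → ‖y‖ * ‖g y‖ ≤ ε)
    {φ : EuclideanSpace ℝ (Fin 3) → EuclideanSpace ℝ (Fin 3)}
    (hφ : Literature.Analysis.FunctionSpaces.IsTestFunctionOn
      (⊤ : TopologicalSpace.Opens (EuclideanSpace ℝ (Fin 3))) φ) :
    Tendsto (fun lam : ℝ => ∫ x, ⟪lam • g (lam • x), φ x⟫) atTop (𝓝 0) := by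
  have hC₀ : 0 ≤ C₀ := by
    have h := henv 0
    rw [norm_zero, zero_add] at h
    by_contra hC
    have : C₀ / a < 0 := div_neg_of_neg_of_pos (not_le.1 hC) ha
    linarith [norm_nonneg (g 0)]
  -- a ball containing the support of `φ`
  obtain ⟨R₀, hR₀⟩ := hφ.hasCompactSupport.isCompact.isBounded.subset_ball (0 : EuclideanSpace ℝ (Fin 3))
  have hφc : Continuous φ := hφ.contDiff.continuous
  have hφ0 : ∀ x, x ∉ ball (0 : EuclideanSpace ℝ (Fin 3)) R₀ → φ x = 0 := fun x hx =>
    image_eq_zero_of_notMem_tsupport fun h => hx (hR₀ h)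
  -- the integrable majorant `C₀ ‖x‖⁻¹ ‖φ x‖`
  set bound : EuclideanSpace ℝ (Fin 3) → ℝ := fun x => C₀ * ‖x‖ ^ (-(1 : ℝ)) * ‖φ x‖ with hbound
  have hint : Integrable bound volume := by
    have h1 : IntegrableOn (fun x : EuclideanSpace ℝ (Fin 3) => ‖x‖ ^ (-(1 : ℝ))) (ball 0 R₀) volume :=
      NewtonPotentialHolder.integrableOn_ball_norm_rpow_neg (by norm_num) R₀
    have h2 : IntegrableOn (fun x : EuclideanSpace ℝ (Fin 3) => ‖x‖ ^ (-(1 : ℝ)) * ‖φ x‖)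
        (ball 0 R₀) volume :=
      h1.mul_continuousOn_of_subset hφc.norm.continuousOn measurableSet_ball
        (isCompact_closedBall 0 R₀) ball_subset_closedBall
    have h3 : IntegrableOn (fun x => C₀ * (‖x‖ ^ (-(1 : ℝ)) * ‖φ x‖)) (ball 0 R₀) volume :=
      h2.const_mul C₀
    have hsupp : support bound ⊆ ball (0 : EuclideanSpace ℝ (Fin 3)) R₀ := by
      intro x hx
      by_contra hxb
      exact hx (by simp [hbound, hφ0 x hxb])
    have e : bound = fun x => C₀ * (‖x‖ ^ (-(1 : ℝ)) * ‖φ x‖) := by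
      funext x; simp only [hbound, mul_assoc]
    rw [← integrableOn_iff_integrable_of_support_subset hsupp, e]
    exact h3
  have h_meas : ∀ᶠ lam : ℝ in atTop,
      AEStronglyMeasurable (fun x => ⟪lam • g (lam • x), φ x⟫) (volume : Measure (EuclideanSpace ℝ (Fin 3))) :=
    Eventually.of_forall fun lam =>
      (((hg.comp (continuous_const_smul lam)).const_smul lam).inner hφc).aestronglyMeasurable
  have h0 : ({0}ᶜ : Set (EuclideanSpace ℝ (Fin 3))) ∈ ae (volume : Measure (EuclideanSpace ℝ (Fin 3))) :=
    compl_mem_ae_iff.2 (measure_singleton 0)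
  have h_bound : ∀ᶠ lam : ℝ in atTop, ∀ᵐ x ∂(volume : Measure (EuclideanSpace ℝ (Fin 3))),
      ‖⟪lam • g (lam • x), φ x⟫‖ ≤ bound x := by
    -- domination for `lam ≥ 0`, off the origin
    filter_upwards [eventually_ge_atTop (0 : ℝ)] with lam hlam
    filter_upwards [h0] with x hx
    have hxn : 0 < ‖x‖ := norm_pos_iff.2 hx
    have h1 : ‖lam • g (lam • x)‖ ≤ C₀ * ‖x‖ ^ (-(1 : ℝ)) := by
      rw [norm_smul, Real.norm_of_nonneg hlam, Real.rpow_neg (norm_nonneg _), Real.rpow_one]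
      have h2 := henv (lam • x)
      rw [norm_smul, Real.norm_of_nonneg hlam] at h2
      have hden : 0 < lam * ‖x‖ + a := by positivity
      calc lam * ‖g (lam • x)‖ ≤ lam * (C₀ / (lam * ‖x‖ + a)) :=
            mul_le_mul_of_nonneg_left h2 hlam
        _ ≤ C₀ * ‖x‖⁻¹ := by
            rw [mul_div_assoc', div_le_iff₀ hden]
            have hx1 : ‖x‖⁻¹ * ‖x‖ = 1 := inv_mul_cancel₀ hxn.ne'
            have e : C₀ * ‖x‖⁻¹ * (lam * ‖x‖ + a) = lam * C₀ + C₀ * ‖x‖⁻¹ * a := by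
              calc C₀ * ‖x‖⁻¹ * (lam * ‖x‖ + a)
                  = lam * C₀ * (‖x‖⁻¹ * ‖x‖) + C₀ * ‖x‖⁻¹ * a := by ring
                _ = lam * C₀ + C₀ * ‖x‖⁻¹ * a := by rw [hx1, mul_one]
            rw [e]
            have : 0 ≤ C₀ * ‖x‖⁻¹ * a := by positivity
            linarith
    calc ‖⟪lam • g (lam • x), φ x⟫‖ ≤ ‖lam • g (lam • x)‖ * ‖φ x‖ := norm_inner_le_norm _ _
      _ ≤ C₀ * ‖x‖ ^ (-(1 : ℝ)) * ‖φ x‖ := mul_le_mul_of_nonneg_right h1 (norm_nonneg _)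
  have h_lim : ∀ᵐ x ∂(volume : Measure (EuclideanSpace ℝ (Fin 3))),
      Tendsto (fun lam : ℝ => ⟪lam • g (lam • x), φ x⟫) atTop (𝓝 ((fun _ => (0 : ℝ)) x)) := by
    -- pointwise convergence off the origin
    filter_upwards [h0] with x hx
    have hxn : 0 < ‖x‖ := norm_pos_iff.2 hx
    rw [show (0 : ℝ) = ⟪(0 : EuclideanSpace ℝ (Fin 3)), φ x⟫ by simp]
    refine Tendsto.inner ?_ tendsto_const_nhds
    rw [tendsto_zero_iff_norm_tendsto_zero]
    refine Metric.tendsto_atTop.2 fun ε hε => ?_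
    obtain ⟨R, hR⟩ := hfar (ε / 2 * ‖x‖) (by positivity)
    refine ⟨max (R / ‖x‖) 0, fun lam hlam => ?_⟩
    have hlam0 : 0 ≤ lam := le_trans (le_max_right _ _) hlam
    have hlamR : R ≤ ‖lam • x‖ := by
      rw [norm_smul, Real.norm_of_nonneg hlam0]
      have := le_trans (le_max_left _ _) hlam
      rwa [div_le_iff₀ hxn] at this
    have key := hR (lam • x) hlamR
    rw [norm_smul, Real.norm_of_nonneg hlam0] at key
    rw [dist_zero_right, norm_norm, norm_smul, Real.norm_of_nonneg hlam0]
    -- `lam ‖x‖ ‖g(lam x)‖ ≤ ε/2 ‖x‖` gives `lam ‖g(lam x)‖ ≤ ε/2 < ε`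
    have h3 : lam * ‖g (lam • x)‖ ≤ ε / 2 := by
      have h4 : lam * ‖g (lam • x)‖ * ‖x‖ ≤ ε / 2 * ‖x‖ := by
        calc lam * ‖g (lam • x)‖ * ‖x‖ = lam * ‖x‖ * ‖g (lam • x)‖ := by ring
          _ ≤ ε / 2 * ‖x‖ := key
      exact le_of_mul_le_mul_right h4 hxn
    linarith
  have key := tendsto_integral_filter_of_dominated_convergence bound h_meas h_bound hint h_lim
  simpa using key

/-- **The far-field leaf of the Type-I DSS wall on the stratum, every `λ > 1`.** A member of the
finite-dissipation Type-I ancient mild stratum which is `c`-DSS on the past (`1 < c`) and has ONE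
slice `w t₀` (`t₀ < 0`) with `‖x‖ ‖w(t₀, x)‖ → 0` as `‖x‖ → ∞` vanishes identically on `t < 0`:
the envelope of the DSS extension bounds `‖w(t₀,x)‖ ≤ C₀/(‖x‖ + √(−t₀))`, so the blow-downs of
the slice are trivial (`tendsto_integral_inner_blowdown_of_farField`) and the blow-down leaf
`eq_zero_of_pastDss_of_blowdown_tendsto_zero` (Albritton–Barker 2019 Thm 4.1) applies. -/
theorem eq_zero_of_pastDss_of_farField_decay {C K c : ℝ}
    {w : ℝ → EuclideanSpace ℝ (Fin 3) → EuclideanSpace ℝ (Fin 3)} (hw : IsTypeIAncientMild C w)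
    (hD : ∀ s : ℝ, s < 0 → ∫⁻ x, ‖fderiv ℝ (w s) x‖ₑ ^ 2 ≤ ENNReal.ofReal (K / Real.sqrt (-s)))
    (hc : 1 < c) (hpast : ∀ t : ℝ, t < 0 → ∀ x, c • w (c ^ 2 * t) (c • x) = w t x)
    {t₀ : ℝ} (ht₀ : t₀ < 0)
    (hfar : ∀ ε > 0, ∃ R : ℝ, ∀ x, R ≤ ‖x‖ → ‖x‖ * ‖w t₀ x‖ ≤ ε) :
    ∀ t < 0, ∀ x, w t x = 0 := by
  -- the envelope of the time-global DSS extension, read at the slice `t₀`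
  obtain ⟨w', hdss', hp⟩ := exists_dss_extension_of_pastDSS (one_pos.trans hc) hpast
  have hw' : IsTypeIAncientMild C w' := CorkscrewProfile.Birth.isTypeIAncientMild_congr_neg hw hp
  have hD' : ∀ s : ℝ, s < 0 →
      ∫⁻ x, ‖fderiv ℝ (w' s) x‖ₑ ^ 2 ≤ ENNReal.ofReal (K / Real.sqrt (-s)) :=
    fun s hs => by rw [hp s hs]; exact hD s hs
  obtain ⟨C₀, henv⟩ := exists_hasTypeIDecay_of_dss hw' hD' hc hdss'
  have henv₀ : ∀ y, ‖w t₀ y‖ ≤ C₀ / (‖y‖ + Real.sqrt (-t₀)) := fun y => by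
    rw [← congrFun (hp t₀ ht₀) y]
    exact henv t₀ ht₀ y
  refine eq_zero_of_pastDss_of_blowdown_tendsto_zero hw hD hc hpast ht₀ fun φ hφ => ?_
  exact tendsto_integral_inner_blowdown_of_farField (hw.continuous_slice ht₀)
    (Real.sqrt_pos.2 (neg_pos.2 ht₀)) henv₀ hfar hφ

/-- **A Type-I DSS singularity is visible at spatial infinity on every slice.** If a past-DSS
member of the finite-dissipation stratum is singular at the apex, then on every slice `t₀ < 0`
there is `ε > 0` such that `‖x‖ ‖w(t₀, x)‖ > ε` at points of arbitrarily large norm (the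
homogeneous final datum does not vanish). -/
theorem farField_limsup_pos_of_pastDss_singular {C K c : ℝ}
    {w : ℝ → EuclideanSpace ℝ (Fin 3) → EuclideanSpace ℝ (Fin 3)} (hw : IsTypeIAncientMild C w)
    (hD : ∀ s : ℝ, s < 0 → ∫⁻ x, ‖fderiv ℝ (w s) x‖ₑ ^ 2 ≤ ENNReal.ofReal (K / Real.sqrt (-s)))
    (hc : 1 < c) (hpast : ∀ t : ℝ, t < 0 → ∀ x, c • w (c ^ 2 * t) (c • x) = w t x)
    (hsing : ∀ r > 0, ∀ M : ℝ, ∃ t ∈ Set.Ioo (-(r ^ 2)) (0 : ℝ),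
      ∃ x ∈ Metric.ball (0 : EuclideanSpace ℝ (Fin 3)) r, M < ‖w t x‖) :
    ∀ t₀ < 0, ∃ ε > 0, ∀ R : ℝ, ∃ x, R ≤ ‖x‖ ∧ ε < ‖x‖ * ‖w t₀ x‖ := by
  intro t₀ ht₀
  by_contra h
  push Not at h
  have hfar : ∀ ε > 0, ∃ R : ℝ, ∀ x, R ≤ ‖x‖ → ‖x‖ * ‖w t₀ x‖ ≤ ε := fun ε hε => h ε hε
  have hz := eq_zero_of_pastDss_of_farField_decay hw hD hc hpast ht₀ hfar
  obtain ⟨t, ht, x, -, hM⟩ := hsing 1 one_pos 0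
  rw [hz t ht.2 x, norm_zero] at hM
  exact lt_irrefl _ hM

end Summit.NavierStokesRegularity.NavierStokesRegularity.Theorems.FiniteDissipationLiouville.Birth

end
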